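import Summits.ValiantsHypothesis.ValiantsHypothesis.Theorems.DefinabilityGapAxisSubstitution
import Summits.ValiantsHypothesis.ValiantsHypothesis.Theses.DefinabilityGap
import Summits.ValiantsHypothesis.ValiantsHypothesis.Theorems.LangWeilTransferShatteringExclusionPerTwoCertificate
import HarnessLib

/-!
# DefinabilityGap — the `Z(per)` transfer: FULL width 2 of the read-once leaf from one leaf about `per_m`

Route `route-ValiantsHypothesis-DefinabilityGap`, width ladder of the read-once leaf F4 / W10 (`KIPlantedHittingRO`,
stmt-ValiantsHypothesis-23704; census v30 next: «FULL width 2 (stall at `M₂(0)⋯M_N(0)`; interior unit failures) /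
width `q^b` — OPEN, second idea needed»). `G_m : z_c ↦ P_c = kiPer m c`, `φ = bind₁ (kiPer m)`.

HONEST GRADE (fixed in advance by the critic, decomp-valiant bus l.1019): «TRANSFER / conditional decision: FULL width 2
⟸ ZperHits₂(m) (kernel), leaf FALSE at m = 2 (kernel), OPEN m ≥ 3 with void-risk tested to bound B; 0 S-currency; K2
untouched; not a rung; rung 0; VP≠VNP untouched». VOID TEST at `m = 3` (bound B, bus NOTE·STEP0 l.1032): «L ≥ 7
non-scalar links necessary for a void, for every field `K ⊇ ℂ`, every 2-local `ℓ_j ∈ K[Y]`, every univariate shape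
(derivation lemma + support census: all 129 cell sets of size ≤ 3 cleared); random search 16.4 M chains of length 7–14
over 198 two-local `ℓ` × 10 shapes × 5 boundary pairs: 0 hits (low power: the same sampler finds no multiple of the
reachable control `y₀₀y₁₁ + y₀₁y₁₀` either)».

THE LEAF `ZperHits₂(m)` (spelled INLINE as the hypothesis `hZ`; no `def : Prop` here): for every field `K` with
`Algebra ℂ K`, no NONZERO value `uᵀ · M₁(ℓ₁) ⋯ M_N(ℓ_N) · v` of a width-2 chain whose links are UNIVARIATE IMAGES
(`M_j ∈ Polynomial K^{2×2}` evaluated at ONE polynomial `ℓ_j ∈ K[Y]`, `Y = (y_{ik})_{i,k<m}`) with 2-LOCAL arguments (`ℓ_j`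
reads at most two of the `m²` cells) is a multiple of `per_m(Y)`: «`Z(per_m)` hits 2-local univariate-image width-2
chains». It is FALSE at `m = 2` (`zperHits_two_fails`: `per₂ = (1,0)·[[1, y₀₀y₁₁],[0,1]]·[[1, y₀₁y₁₀],[0,1]]·(0,1)ᵀ`) and
OPEN for `m ≥ 3`; it mentions neither `q`, nor the design, nor the `q³` dependent block permanents.

THE TRANSFER (`chainVal_eq_zero_of_bind₁_kiPer`, KERNEL): `ZperHits₂(m)` ⟹ `φ` annihilates NO nonzero width-2 read-once
block chain `uᵀ·∏_j M_j(z_{c_j})·v` (distinct blocks, ANY order, ANY length, ARBITRARY univariate links — interior unit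
failures and the `M₂(0)⋯M_N(0)` stall of the axis substitution included); `kiPer_hits_isROABP_two` = the same in the
currency of `KIPlantedHittingRO` (`IsROABP ℂ 2 d π D`, every `d`, every order `π`). PROOF: expand `D` at its head link,
`D = Σ_t z_c^t · D_t` (`chainVal_cons_ulink`); apply `φ` and the CHART `Φ_c : ℂ[y] → K[Y]`, `K = Frac ℂ[y]` (cells of
`c ↦ Y`, every other seed `↦` its own constant; injective; `Φ_c(P_c) = per_m(Y)`; `Φ_c(P_{c'})` 2-local for `c' ≠ c` since
two blocks share `≤ 2` cells — the NW design used once, linearly): `Σ_t per^t · Φ_c(φ D_t) = 0` with each `Φ_c(φ D_t)` the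
value of a 2-local univariate-image chain over `K` (`chart_bind₁_chainVal`); peeling powers of `per` with the leaf
(`eq_zero_of_sum_pow_mul`) gives `Φ_c(φ D_t) = 0`, so `φ D_t = 0`, so `D_t = 0` by induction on the length, so `D = 0`.
PLACEMENT: a TRANSFER, not a rung — FULL width 2 (all `m ≥ 3` at once) rides on ONE statement about ONE `m × m`
permanent whose void-risk is the Allender–Wang phenomenon, tested to the bound above, not excluded. 0 S-currency ·
`K1`/`K2`/`b ≥ 2`/VP ≠ VNP untouched · no facts · no `def : Prop`.
-/

open MvPolynomial Finset
open Literature.Computability.AlgebraicComplexity Literature.Computability.MetaComplexity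

namespace Summit.ValiantsHypothesis.ValiantsHypothesis.Theorems.DefinabilityGapZperTransfer

open DefinabilityGapAffineRung DefinabilityGapAxisSubstitution DefinabilityGapZeroedBlocks

noncomputable section

/-! ## 1. Width-2 chains with univariate-image links -/

/-- The value `uᵀ · N₁ ⋯ N_N · v` of a width-2 chain with links `N_j` (2 × 2 matrices over a polynomial ring) and
constant boundary vectors `u, v`. [this file] -/
def chainVal {σ R : Type*} [CommSemiring R] (l : List (Matrix (Fin 2) (Fin 2) (MvPolynomial σ R)))
    (u v : Fin 2 → R) : MvPolynomial σ R :=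
  ∑ i, C (u i) * (l.prod.mulVec (fun k => C (v k))) i

/-- A univariate-image link `M(ℓ)`: the univariate matrix `M ∈ Polynomial K^{2×2}` evaluated at one polynomial `ℓ`. [this file] -/
def ulink {σ K : Type*} [CommSemiring K] (e : Matrix (Fin 2) (Fin 2) (Polynomial K) × MvPolynomial σ K) :
    Matrix (Fin 2) (Fin 2) (MvPolynomial σ K) :=
  e.1.map (Polynomial.aeval e.2)
/-- The coefficient start vectors `uᵀ K_t` of the head-link expansion (`K_t` = the `X^t`-coefficient matrix of `M`). [this file] -/
def coeffVec {K : Type*} [CommSemiring K] (M : Matrix (Fin 2) (Fin 2) (Polynomial K)) (u : Fin 2 → K) (t : ℕ) : Fin 2 → K :=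
  fun k => ∑ i, u i * (M i k).coeff t
/-- The empty chain computes the constant `uᵀv`. [this file] -/
theorem chainVal_nil {σ R : Type*} [CommSemiring R] (u v : Fin 2 → R) :
    chainVal ([] : List (Matrix (Fin 2) (Fin 2) (MvPolynomial σ R))) u v = C (∑ i, u i * v i) := by
  rw [map_sum]
  simp only [chainVal, List.prod_nil, Matrix.one_mulVec, C_mul]
/-- HEAD-LINK EXPANSION: `uᵀ M(x) W v = Σ_t x^t · (uᵀK_t) W v`. [this file] -/
theorem chainVal_cons_ulink {σ K : Type*} [CommSemiring K] (M : Matrix (Fin 2) (Fin 2) (Polynomial K)) (x : MvPolynomial σ K)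
    (l : List (Matrix (Fin 2) (Fin 2) (MvPolynomial σ K))) (u v : Fin 2 → K) {n : ℕ}
    (hn : ∀ i k, (M i k).natDegree < n) :
    chainVal (ulink (M, x) :: l) u v = ∑ t ∈ Finset.range n, x ^ t * chainVal l (coeffVec M u t) v := by
  have hM : ∀ i k, ulink (M, x) i k = ∑ t ∈ Finset.range n, C ((M i k).coeff t) * x ^ t := by
    intro i k
    simp only [ulink, Matrix.map_apply]
    rw [Polynomial.aeval_eq_sum_range' (hn i k)]
    simp only [MvPolynomial.smul_eq_C_mul]
  simp only [chainVal, List.prod_cons, ← Matrix.mulVec_mulVec]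
  simp only [Matrix.mulVec, dotProduct, Fin.sum_univ_two, hM, coeffVec]
  simp only [Finset.sum_mul, Finset.mul_sum, mul_add, map_add, map_mul, ← Finset.sum_add_distrib]
  refine Finset.sum_congr rfl fun t _ => ?_
  ring
/-- Ring homomorphisms act on chain values link by link. [this file] -/
theorem map_chainVal {σ τ R S : Type*} [CommSemiring R] [CommSemiring S]
    (ψ : MvPolynomial σ R →+* MvPolynomial τ S) (g : R →+* S) (hψ : ∀ a, ψ (C a) = C (g a))
    (l : List (Matrix (Fin 2) (Fin 2) (MvPolynomial σ R))) (u v : Fin 2 → R) :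
    ψ (chainVal l u v) = chainVal (l.map fun N => N.map ψ) (fun i => g (u i)) (fun k => g (v k)) := by
  have h1 : (l.prod).map ψ = (l.map fun N => N.map ψ).prod := by
    rw [← RingHom.mapMatrix_apply, map_list_prod]
    rfl
  have h2 : (⇑ψ ∘ fun k => C (v k)) = fun k => C (g (v k)) := funext fun k => hψ (v k)
  unfold chainVal
  rw [map_sum]
  refine Finset.sum_congr rfl fun i _ => ?_
  rw [map_mul, hψ, RingHom.map_mulVec, h1, h2]
/-- Ring homomorphisms act on univariate-image links by mapping the coefficients and the argument. [this file] -/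
theorem map_ulink {σ τ R S : Type*} [CommSemiring R] [CommSemiring S]
    (ψ : MvPolynomial σ R →+* MvPolynomial τ S) (g : R →+* S) (hψ : ∀ a, ψ (C a) = C (g a))
    (M : Matrix (Fin 2) (Fin 2) (Polynomial R)) (x : MvPolynomial σ R) :
    (ulink (M, x)).map ψ = ulink (M.map (Polynomial.map g), ψ x) := by
  have hφ : ψ.comp (algebraMap R (MvPolynomial σ R)) = (algebraMap S (MvPolynomial τ S)).comp g :=
    RingHom.ext fun a => by simp only [RingHom.comp_apply, MvPolynomial.algebraMap_eq, hψ]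
  refine Matrix.ext fun i k => ?_
  simp only [ulink, Matrix.map_apply]
  rw [Polynomial.aeval_def, Polynomial.aeval_def, Polynomial.hom_eval₂, Polynomial.eval₂_map, hφ]
/-- PEELING POWERS: if `Σ_{t<n} p^t · G_t = 0` in a domain, `p ≠ 0`, and no `G_t` is a NONZERO multiple of `p`, then every
`G_t` vanishes. [this file] -/
theorem eq_zero_of_sum_pow_mul {A : Type*} [CommRing A] [IsDomain A] {p : A} (hp : p ≠ 0) :
    ∀ (n : ℕ) (G : ℕ → A), (∀ t H, G t = p * H → G t = 0) →
      ∑ t ∈ Finset.range n, p ^ t * G t = 0 → ∀ t < n, G t = 0 := by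
  intro n
  induction n with
  | zero => intro G _ _ t ht; exact absurd ht (Nat.not_lt_zero t)
  | succ n ih =>
    intro G hG hs t ht
    have e : ∑ t ∈ Finset.range (n + 1), p ^ t * G t = G 0 + p * ∑ t ∈ Finset.range n, p ^ t * G (t + 1) := by
      rw [Finset.sum_range_succ', Finset.mul_sum, add_comm, pow_zero, one_mul]
      congr 1
      exact Finset.sum_congr rfl fun t _ => by ring
    rw [e] at hs
    have h0 : G 0 = 0 :=
      hG 0 (-(∑ t ∈ Finset.range n, p ^ t * G (t + 1))) (by linear_combination hs)
    have hS : ∑ t ∈ Finset.range n, p ^ t * G (t + 1) = 0 := by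
      rw [h0, zero_add] at hs
      exact (mul_eq_zero.1 hs).resolve_left hp
    cases t with
    | zero => exact h0
    | succ s => exact ih (fun t => G (t + 1)) (fun t H h => hG (t + 1) H h) hS s (by omega)

/-! ## 2. Block chains of the planted generator -/

variable {m : ℕ}

/-- A width-2 link of a read-once block chain: a block `blk` and its univariate link matrix `M ∈ Polynomial ℂ^{2×2}`. [this file] -/
structure W2Link (m : ℕ) where
  /-- the block variable read by the link -/
  blk : Fin 3 → Fin (qOf m)
  /-- the univariate link matrix -/
  M : Matrix (Fin 2) (Fin 2) (Polynomial ℂ)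
/-- The link matrix `M(z_blk)` over `ℂ[z]`. [this file] -/
def W2Link.mat (L : W2Link m) : Matrix (Fin 2) (Fin 2) (MvPolynomial (Fin 3 → Fin (qOf m)) ℂ) :=
  ulink (L.M, X L.blk)

/-! ## 3. The chart `Φ_c : ℂ[y] → K[Y]`, `K = Frac ℂ[y]` -/
/-- The ambient field `K = Frac ℂ[y]` of the chart. [this file] -/
abbrev Kfrac (m : ℕ) : Type := FractionRing (MvPolynomial (Fin (qOf m) × Fin (qOf m)) ℂ)
/-- The constants `ℂ → K`. [this file] -/
def toKfrac (m : ℕ) : ℂ →+* Kfrac m :=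
  (algebraMap (MvPolynomial (Fin (qOf m) × Fin (qOf m)) ℂ) (Kfrac m)).comp C
/-- The chart on variables: the cells of block `c` become the fresh variables `Y`, every other seed its own constant
in `K`. [this file] -/
def chartVar (m : ℕ) (c : Fin 3 → Fin (qOf m)) :
    Fin (qOf m) × Fin (qOf m) → MvPolynomial (Fin m × Fin m) (Kfrac m) :=
  Function.extend (cellEmb m c) (fun p => X p)
    (fun s => C (algebraMap (MvPolynomial (Fin (qOf m) × Fin (qOf m)) ℂ) (Kfrac m) (X s)))
/-- THE CHART `Φ_c : ℂ[y] →+* K[Y]`. [this file] -/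
def chart (m : ℕ) (c : Fin 3 → Fin (qOf m)) :
    MvPolynomial (Fin (qOf m) × Fin (qOf m)) ℂ →+* MvPolynomial (Fin m × Fin m) (Kfrac m) :=
  eval₂Hom (C.comp (toKfrac m)) (chartVar m c)
/-- The left inverse of the chart: `Y_p ↦ y_{E_c(p)}`. [this file] -/
def chartInv (m : ℕ) (c : Fin 3 → Fin (qOf m)) : MvPolynomial (Fin m × Fin m) (Kfrac m) →+* Kfrac m :=
  eval fun p => algebraMap (MvPolynomial (Fin (qOf m) × Fin (qOf m)) ℂ) (Kfrac m) (X (cellEmb m c p))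
/-- `Φ_c` on a cell of `c`. [this file] -/
theorem chartVar_cellEmb (c : Fin 3 → Fin (qOf m)) (p : Fin m × Fin m) : chartVar m c (cellEmb m c p) = X p :=
  (cellEmb m c).injective.extend_apply _ _ p
/-- `Φ_c` off the cells of `c`. [this file] -/
theorem chartVar_of_not_exists (c : Fin 3 → Fin (qOf m)) {s : Fin (qOf m) × Fin (qOf m)} (hs : ¬ ∃ p, cellEmb m c p = s) :
    chartVar m c s = C (algebraMap (MvPolynomial (Fin (qOf m) × Fin (qOf m)) ℂ) (Kfrac m) (X s)) :=
  Function.extend_apply' _ _ _ hs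
/-- `Φ_c` on constants. [this file] -/
theorem chart_C (c : Fin 3 → Fin (qOf m)) (a : ℂ) : chart m c (C a) = C (toKfrac m a) := eval₂Hom_C _ _ _
/-- `Φ_c` on variables. [this file] -/
theorem chart_X (c : Fin 3 → Fin (qOf m)) (s : Fin (qOf m) × Fin (qOf m)) : chart m c (X s) = chartVar m c s :=
  eval₂Hom_X' _ _ _
/-- `Φ_c⁻¹ ∘ Φ_c = (ℂ[y] ↪ K)`. [this file] -/
theorem chartInv_comp_chart (c : Fin 3 → Fin (qOf m)) :
    (chartInv m c).comp (chart m c) = algebraMap (MvPolynomial (Fin (qOf m) × Fin (qOf m)) ℂ) (Kfrac m) := by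
  refine ringHom_ext (fun a => ?_) (fun s => ?_)
  · rw [RingHom.comp_apply, chart_C, chartInv, eval_C]
    rfl
  · rw [RingHom.comp_apply, chart_X, chartInv]
    by_cases hs : ∃ p, cellEmb m c p = s
    · obtain ⟨p, rfl⟩ := hs
      rw [chartVar_cellEmb, eval_X]
    · rw [chartVar_of_not_exists c hs, eval_C]
/-- THE CHART IS INJECTIVE. [this file] -/
theorem chart_injective (c : Fin 3 → Fin (qOf m)) : Function.Injective (chart m c) := by
  intro a b hab
  have h := congrArg (chartInv m c) hab
  rw [← RingHom.comp_apply, ← RingHom.comp_apply, chartInv_comp_chart] at h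
  exact IsFractionRing.injective (MvPolynomial (Fin (qOf m) × Fin (qOf m)) ℂ) (Kfrac m) h
/-- `Φ_c(P_c) = per_m(Y)`. [this file] -/
theorem chart_kiPer_self (c : Fin 3 → Fin (qOf m)) : chart m c (kiPer m c) = perPoly (Fin m) (Kfrac m) := by
  have hmap : (eval₂Hom (C.comp (toKfrac m)) X :
      MvPolynomial (Fin m × Fin m) ℂ →+* MvPolynomial (Fin m × Fin m) (Kfrac m)) = map (toKfrac m) :=
    ringHom_ext (fun a => by simp) (fun i => by simp)
  have hfun : (chartVar m c ∘ cellEmb m c : Fin m × Fin m → MvPolynomial (Fin m × Fin m) (Kfrac m)) = X :=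
    funext fun p => chartVar_cellEmb c p
  rw [kiPer_eq_rename_cellEmb, chart, coe_eval₂Hom, eval₂_rename, hfun, ← coe_eval₂Hom, hmap, map_perPoly]

/-- `Φ_c = bind₁ (chartVar) ∘ map (ℂ → K)`. [this file] -/
theorem chart_eq_bind₁_map (c : Fin 3 → Fin (qOf m)) (p : MvPolynomial (Fin (qOf m) × Fin (qOf m)) ℂ) :
    chart m c p = bind₁ (chartVar m c) (map (toKfrac m) p) := by
  have h : chart m c = (bind₁ (chartVar m c)).toRingHom.comp (map (toKfrac m)) :=
    ringHom_ext (fun a => by simp [chart]) (fun s => by simp [chart])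
  rw [h]
  rfl

/-- 2-LOCALITY: for `c' ≠ c`, `Φ_c(P_{c'})` reads at most two of the `Y`-variables (two blocks share `≤ 2` cells).
[this file] -/
theorem exists_vars_chart_kiPer {c c' : Fin 3 → Fin (qOf m)} (hcc' : c' ≠ c) :
    ∃ S : Finset (Fin m × Fin m), S.card ≤ 2 ∧ (chart m c (kiPer m c')).vars ⊆ S := by
  classical
  refine ⟨patOf m (cells m c') c, ?_, fun x hx => ?_⟩
  · rw [card_patOf]
    exact card_cells_inter_le hcc'.symm
  · rw [chart_eq_bind₁_map] at hx
    obtain ⟨s, hs, hxs⟩ := Finset.mem_biUnion.1 (vars_bind₁ _ _ hx)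
    have hs' : s ∈ cells m c' := by
      have hs2 : s ∈ (kiPer m c').vars := vars_map _ _ hs
      rw [kiPer_eq_rename_cellEmb] at hs2
      obtain ⟨ij, -, rfl⟩ := Finset.mem_image.1 (vars_rename _ _ hs2)
      exact Finset.mem_map_of_mem _ (Finset.mem_univ _)
    by_cases hsc : ∃ p, cellEmb m c p = s
    · obtain ⟨p, rfl⟩ := hsc
      rw [chartVar_cellEmb, vars_X, Finset.mem_singleton] at hxs
      subst hxs
      exact mem_patOf.2 hs'
    · rw [chartVar_of_not_exists c hsc, vars_C] at hxs
      simp at hxs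

/-! ## 4. Pushing a block chain through `Φ_c ∘ φ` -/

/-- `Ψ_c = Φ_c ∘ φ`. [this file] -/
def pushHom (m : ℕ) (c : Fin 3 → Fin (qOf m)) :
    MvPolynomial (Fin 3 → Fin (qOf m)) ℂ →+* MvPolynomial (Fin m × Fin m) (Kfrac m) :=
  (chart m c).comp (bind₁ (kiPer m)).toRingHom

/-- `Ψ_c D = Φ_c (φ D)`. [this file] -/
theorem pushHom_apply (c : Fin 3 → Fin (qOf m)) (D : MvPolynomial (Fin 3 → Fin (qOf m)) ℂ) :
    pushHom m c D = chart m c (bind₁ (kiPer m) D) := rfl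

/-- `Ψ_c` on constants. [this file] -/
theorem pushHom_C (c : Fin 3 → Fin (qOf m)) (a : ℂ) : pushHom m c (C a) = C (toKfrac m a) := by
  rw [pushHom_apply, bind₁_C_right, chart_C]

/-- The pushed links: `M_j ↦ M_j` (coefficients in `K`), `z_{c_j} ↦ Φ_c(P_{c_j})`. [this file] -/
def pushLinks (m : ℕ) (c : Fin 3 → Fin (qOf m)) (rest : List (W2Link m)) :
    List (Matrix (Fin 2) (Fin 2) (Polynomial (Kfrac m)) × MvPolynomial (Fin m × Fin m) (Kfrac m)) :=
  rest.map fun L' => (L'.M.map (Polynomial.map (toKfrac m)), chart m c (kiPer m L'.blk))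

/-- `Φ_c(φ(uᵀ ∏ M_j(z_{c_j}) v))` is the value of the pushed chain over `K`. [this file] -/
theorem chart_bind₁_chainVal (c : Fin 3 → Fin (qOf m)) (rest : List (W2Link m)) (u v : Fin 2 → ℂ) :
    chart m c (bind₁ (kiPer m) (chainVal (rest.map W2Link.mat) u v)) =
      chainVal ((pushLinks m c rest).map ulink) (fun i => toKfrac m (u i)) (fun k => toKfrac m (v k)) := by
  rw [← pushHom_apply, map_chainVal (pushHom m c) (toKfrac m) (pushHom_C c)]
  congr 1
  rw [List.map_map, pushLinks, List.map_map]
  refine List.map_congr_left fun L' _ => ?_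
  show (ulink (L'.M, X L'.blk)).map (pushHom m c) =
    ulink (L'.M.map (Polynomial.map (toKfrac m)), chart m c (kiPer m L'.blk))
  rw [map_ulink (pushHom m c) (toKfrac m) (pushHom_C c), pushHom_apply, bind₁_X_right]

/-- The pushed links of the blocks `≠ c` are 2-local. [this file] -/
theorem pushLinks_local {c : Fin 3 → Fin (qOf m)} {rest : List (W2Link m)} (hc : c ∉ rest.map W2Link.blk) :
    ∀ e ∈ pushLinks m c rest, ∃ S : Finset (Fin m × Fin m), S.card ≤ 2 ∧ e.2.vars ⊆ S := by
  intro e he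
  obtain ⟨L', hL', rfl⟩ := List.mem_map.1 he
  exact exists_vars_chart_kiPer fun hEq => hc (List.mem_map.2 ⟨L', hL', hEq⟩)

/-! ## 5. The transfer -/

/-- **THE `Z(per)` TRANSFER** (KERNEL): if `Z(per_m)` hits the 2-local univariate-image width-2 chains over every field
`K ⊇ ℂ` (the leaf `hZ`), then `φ = bind₁ (kiPer m)` annihilates no nonzero width-2 read-once block chain — distinct
blocks, any order, any length, arbitrary univariate links. [this file] -/
theorem chainVal_eq_zero_of_bind₁_kiPer
    (hZ : ∀ (K : Type) [Field K] [Algebra ℂ K]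
      (l : List (Matrix (Fin 2) (Fin 2) (Polynomial K) × MvPolynomial (Fin m × Fin m) K)),
      (∀ e ∈ l, ∃ S : Finset (Fin m × Fin m), S.card ≤ 2 ∧ e.2.vars ⊆ S) →
      ∀ (u v : Fin 2 → K) (H : MvPolynomial (Fin m × Fin m) K),
        chainVal (l.map ulink) u v = perPoly (Fin m) K * H → chainVal (l.map ulink) u v = 0) :
    ∀ l : List (W2Link m), (l.map W2Link.blk).Nodup → ∀ u v : Fin 2 → ℂ,
      bind₁ (kiPer m) (chainVal (l.map W2Link.mat) u v) = 0 → chainVal (l.map W2Link.mat) u v = 0 := by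
  intro l
  induction l with
  | nil =>
    intro _ u v h
    rw [List.map_nil, chainVal_nil] at h ⊢
    rw [bind₁_C_right, C_eq_zero] at h
    exact C_eq_zero.2 h
  | cons L rest ih =>
    intro hnd u v h
    rw [List.map_cons, List.nodup_cons] at hnd
    obtain ⟨n, hn⟩ : ∃ n : ℕ, ∀ i k, (L.M i k).natDegree < n :=
      ⟨(Finset.univ.sup fun ik : Fin 2 × Fin 2 => (L.M ik.1 ik.2).natDegree) + 1, fun i k =>
        Nat.lt_succ_of_le (Finset.le_sup (f := fun ik : Fin 2 × Fin 2 => (L.M ik.1 ik.2).natDegree)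
          (Finset.mem_univ (i, k)))⟩
    have hexp : chainVal ((L :: rest).map W2Link.mat) u v =
        ∑ t ∈ Finset.range n, X L.blk ^ t * chainVal (rest.map W2Link.mat) (coeffVec L.M u t) v :=
      chainVal_cons_ulink L.M (X L.blk) (rest.map W2Link.mat) u v hn
    rw [hexp] at h ⊢
    have hGt : ∀ t < n,
        chart m L.blk (bind₁ (kiPer m) (chainVal (rest.map W2Link.mat) (coeffVec L.M u t) v)) = 0 := by
      have h2 := congrArg (chart m L.blk) h
      rw [map_sum, map_sum, map_zero] at h2
      simp only [map_mul, map_pow, bind₁_X_right, chart_kiPer_self] at h2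
      refine eq_zero_of_sum_pow_mul (perPoly_ne_zero (Fin m) (Kfrac m)) n
        (fun t => chart m L.blk (bind₁ (kiPer m) (chainVal (rest.map W2Link.mat) (coeffVec L.M u t) v)))
        (fun t H hH => ?_) h2
      beta_reduce at hH ⊢
      rw [chart_bind₁_chainVal] at hH ⊢
      exact hZ (Kfrac m) (pushLinks m L.blk rest) (pushLinks_local hnd.1) _ _ H hH
    refine Finset.sum_eq_zero fun t ht => ?_
    have hb : bind₁ (kiPer m) (chainVal (rest.map W2Link.mat) (coeffVec L.M u t) v) = 0 :=
      chart_injective L.blk (by rw [hGt t (Finset.mem_range.1 ht), map_zero])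
    rw [ih hnd.2 _ v hb, mul_zero]

/-- **FULL WIDTH 2 OF THE READ-ONCE LEAF FROM THE LEAF `ZperHits₂(m)`**, in the currency of `KIPlantedHittingRO`
(`w = 2`, every degree `d`, every variable order `π`, every length `N`). [this file] -/
theorem kiPer_hits_isROABP_two
    (hZ : ∀ (K : Type) [Field K] [Algebra ℂ K]
      (l : List (Matrix (Fin 2) (Fin 2) (Polynomial K) × MvPolynomial (Fin m × Fin m) K)),
      (∀ e ∈ l, ∃ S : Finset (Fin m × Fin m), S.card ≤ 2 ∧ e.2.vars ⊆ S) →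
      ∀ (u v : Fin 2 → K) (H : MvPolynomial (Fin m × Fin m) K),
        chainVal (l.map ulink) u v = perPoly (Fin m) K * H → chainVal (l.map ulink) u v = 0)
    {N d : ℕ} (π : Fin N ≃ (Fin 3 → Fin (qOf m))) (D : MvPolynomial (Fin 3 → Fin (qOf m)) ℂ) (hD : D ≠ 0)
    (hR : IsROABP ℂ 2 d π D) : bind₁ (kiPer m) D ≠ 0 := by
  obtain ⟨hw, M, hM, hDM⟩ := hR
  choose p hp using hM
  let lk : Fin N → W2Link m := fun i => ⟨π i, Matrix.of fun a b => p i a b⟩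
  have hmat : ∀ i, (lk i).mat = M i := fun i => by
    refine Matrix.ext fun a b => ?_
    simp only [W2Link.mat, ulink, Matrix.map_apply, Matrix.of_apply, lk]
    exact (hp i a b).2.symm
  have hl : (List.ofFn lk).map W2Link.mat = List.ofFn M := by
    rw [List.map_ofFn]
    exact congrArg List.ofFn (funext hmat)
  have hnd : ((List.ofFn lk).map W2Link.blk).Nodup := by
    rw [List.map_ofFn]
    exact List.nodup_ofFn_ofInjective π.injective
  have hDval : D = chainVal ((List.ofFn lk).map W2Link.mat) ![1, 0] ![1, 0] := by
    rw [hl, hDM, chainVal]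
    simp [Matrix.mulVec, dotProduct, Fin.sum_univ_two]
  intro h0
  apply hD
  rw [hDval] at h0 ⊢
  exact chainVal_eq_zero_of_bind₁_kiPer hZ _ hnd _ _ h0

/-! ## 6. The leaf fails at `m = 2` -/

/-- **THE LEAF IS FALSE AT `m = 2`**: `per₂ = (1,0)·[[1, y₀₀y₁₁],[0,1]]·[[1, y₀₁y₁₀],[0,1]]·(0,1)ᵀ` is a nonzero
2-local univariate-image width-2 chain value divisible by `per₂`. [this file] -/
theorem zperHits_two_fails : ¬ ∀ (K : Type) [Field K] [Algebra ℂ K]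
      (l : List (Matrix (Fin 2) (Fin 2) (Polynomial K) × MvPolynomial (Fin 2 × Fin 2) K)),
      (∀ e ∈ l, ∃ S : Finset (Fin 2 × Fin 2), S.card ≤ 2 ∧ e.2.vars ⊆ S) →
      ∀ (u v : Fin 2 → K) (H : MvPolynomial (Fin 2 × Fin 2) K),
        chainVal (l.map ulink) u v = perPoly (Fin 2) K * H → chainVal (l.map ulink) u v = 0 := by
  intro hZ
  have hloc : ∀ p q : Fin 2 × Fin 2, ∃ S : Finset (Fin 2 × Fin 2), S.card ≤ 2 ∧
      (X p * X q : MvPolynomial (Fin 2 × Fin 2) ℂ).vars ⊆ S := fun p q =>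
    ⟨{p, q}, Finset.card_le_two, (vars_mul _ _).trans (by rw [vars_X, vars_X]; intro x hx; simpa using hx)⟩
  have h2loc : ∀ e ∈ [((!![1, Polynomial.X; 0, 1] : Matrix (Fin 2) (Fin 2) (Polynomial ℂ)),
        (X (0, 0) * X (1, 1) : MvPolynomial (Fin 2 × Fin 2) ℂ)),
      ((!![1, Polynomial.X; 0, 1] : Matrix (Fin 2) (Fin 2) (Polynomial ℂ)), (X (0, 1) * X (1, 0) : MvPolynomial (Fin 2 × Fin 2) ℂ))],
      ∃ S : Finset (Fin 2 × Fin 2), S.card ≤ 2 ∧ e.2.vars ⊆ S := by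
    intro e he
    rcases List.mem_cons.1 he with rfl | he
    · exact hloc _ _
    rcases List.mem_cons.1 he with rfl | he
    · exact hloc _ _
    exact absurd he List.not_mem_nil
  have hval := hZ ℂ _ h2loc ![1, 0] ![0, 1] 1
  have hchain : chainVal ([((!![1, Polynomial.X; 0, 1] : Matrix (Fin 2) (Fin 2) (Polynomial ℂ)),
        (X (0, 0) * X (1, 1) : MvPolynomial (Fin 2 × Fin 2) ℂ)),
      ((!![1, Polynomial.X; 0, 1] : Matrix (Fin 2) (Fin 2) (Polynomial ℂ)), (X (0, 1) * X (1, 0) : MvPolynomial (Fin 2 × Fin 2) ℂ))].map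
        ulink) ![1, 0] ![0, 1] = perPoly (Fin 2) ℂ := by
    rw [LangWeilTransfer.ShatteringExclusion.PerTwo.perPoly_fin_two]
    simp [chainVal, ulink, Matrix.mulVec, dotProduct, Fin.sum_univ_two, Matrix.mul_apply, add_comm]
  rw [hchain] at hval
  exact perPoly_ne_zero (Fin 2) ℂ (hval (by rw [mul_one]))

end

end Summit.ValiantsHypothesis.ValiantsHypothesis.Theorems.DefinabilityGapZperTransfer
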